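import Literature.Geometry.ComplexAnalytic.SectionTubularChart      -- ★ p849219 `exists_sectionTubularChart` (LA7-p02 (g2))
import Literature.Analysis.Complex.KoenigsLinearization             -- ★ p849119 O3 «KOENIGS-PARAM» (LA5-plan (g2)): `exists_linearizing_openPartialHomeomorph`
import HarnessLib

/-!
# The linearising chart of an étale self-map along a section of zeros (Poincaré–Kœnigs with parameters on a family)
# ([Koenigs1884]; [Sternberg1957] Thm. 1; [Milnor2006] Thm. 8.2, Cor. 8.4; [FritzscheGrauert2002] Ch. I §7 Thm. 7.6)

Layer `Literature/Geometry/ComplexAnalytic`, namespace `Literature.Geometry.ComplexAnalytic.DoublingLinearisingChart`.  THEOREMS ONLY (no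
definition, no named fact, no instance, no notation, no `sorry`).  Cell `hodgecm-mathlib`, «L8-PREP» road B (HOME-only prep for the E-line's printed
residue P-1 `relativeExponentialUniformisation`), organ B2 «LINCHART» of LA7-plan (g2)'s skeleton `StubFLOW.roadB` (`RoadB.LINCHART` :183, ED. 3 0b96e951),
paid by LA7-p02 (g2) (deal 2026-09-02T04:28:26Z).  HC_CM is proved only modulo the 7 printed citations (2 remaining: hLiu418 = stmt-HodgeConjecture-24832,
h413 = stmt-HodgeConjecture-24833) until rung 0 closes; generic complex-analytic geometry, count-neutral.

SETTING.  Complex manifolds `MA` (model `EA`), `MS` (model `ES`), a normed space `F` with `dim EA = dim ES + dim F` (finite-dimensional); `C^ω` maps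
`p : MA → MS` («base point»), `zero : MS → MA` (a section: `p ∘ zero = id`) and `two : MA → MA` (a self-map over `p` fixing the section: `p ∘ two = p`,
`two ∘ zero = zero`); a multiplier `c : ℂ`, `1 < ‖c‖`; and through every `zero u` a holomorphic map `πᵤ : F → MA` into the fibre `p⁻¹ u` with
`two ∘ πᵤ = πᵤ ∘ (c • ·)` and injective differential at `0`.  In print (road B at `c = 2`): `two = [2]^an`, `zero` = the identity section,
`πᵤ` = the uniformisation `ℂ^g → A_u(ℂ)` of the fibre of an abelian scheme; then `d(two)` IS `2` on the vertical tangent space along the section, with no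
resonances, and Kœnigs' linearisation `lim_k c^{-k} • (two)^{∘k}` in the fibre coordinate of a tubular chart converges to a chart conjugating `two` to
`(u, w) ↦ (u, c • w)`.

* §1 bridges between the product model `𝓘(ℂ, ES).prod 𝓘(ℂ, F)` and the self model `𝓘(ℂ, ES × F)` on `ES × F` (Mathlib `modelWithCornersSelf_prod`,
  `chartedSpaceSelf_prod`), and the `C^ω` regularity of `(chartAt m)⁻¹ × id`, `(chartAt m) × id`.
* §2 `fderiv_vertical_eq_smul` — THE VERTICAL MULTIPLIER IS `c`, CHART-INDEPENDENTLY: in a tubular chart `Θ₀ : MA ⇀ ES × F` (bi-`C^ω`) whose first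
  coordinate is constant on a dilation-equivariant immersion-at-`0` `π : F → MA` through `Θ₀⁻¹ (b, 0)`, the fibre derivative at `0` of the second
  coordinate `G (b, ·)` of `Θ₀ ∘ two ∘ Θ₀⁻¹` is `c • id` (conjugate `G (b, ·)` by `τ := pr₂ ∘ Θ₀ ∘ π`, whose derivative at `0` is invertible because
  `d(Θ₀ ∘ π)(0) = dΘ₀ ∘ dπ(0)` is injective with vanishing first component).
* §3 **`exists_linearising_chart`** = the BODY of `RoadB.LINCHART` with `basePoint ↦ p`, `2 ↦ c` (+ `hp : ContMDiff ω p`, `hdim`): the tubular chart of ★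
  `SectionTubularChart.exists_sectionTubularChart`, then ★ `KoenigsLinearization.exists_linearizing_openPartialHomeomorph` (O3 §4) for `G` on its
  image (`G (b, 0) = 0`, `∂_w G (b, 0) = c • id` by §2), then back to `MS × F` by `(chartAt m)⁻¹ × id`.

## References
* [Koenigs1884] G. Kœnigs, *Recherches sur les intégrales de certaines équations fonctionnelles*, Ann. Sci. ÉNS (3) 1 (1884), Suppl. 3–41.
* [Sternberg1957] S. Sternberg, *Local contractions and a theorem of Poincaré*, Amer. J. Math. 79 (1957), Thm. 1.
* [Milnor2006] J. Milnor, *Dynamics in One Complex Variable*, 3rd ed. (2006), §8 Thm. 8.2, Rem. 8.3, Cor. 8.4.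
* [FritzscheGrauert2002] K. Fritzsche, H. Grauert, *From Holomorphic Functions to Complex Manifolds* (2002), Ch. I §7 Thm. 7.6.
-/

set_option autoImplicit false

open scoped Manifold ContDiff Topology
open Set Function Filter Module Metric

noncomputable section

namespace Literature.Geometry.ComplexAnalytic.DoublingLinearisingChart

variable {EA : Type*} [NormedAddCommGroup EA] [NormedSpace ℂ EA] [FiniteDimensional ℂ EA]
  {ES : Type*} [NormedAddCommGroup ES] [NormedSpace ℂ ES] [FiniteDimensional ℂ ES]
  {F : Type*} [NormedAddCommGroup F] [NormedSpace ℂ F] [FiniteDimensional ℂ F]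
  {MA : Type*} [TopologicalSpace MA] [ChartedSpace EA MA]
  {MS : Type*} [TopologicalSpace MS] [ChartedSpace ES MS]

/-! ## §1 Product model versus self model on `ES × F` -/

omit [FiniteDimensional ℂ ES] [FiniteDimensional ℂ F] in
/-- A `C^n` map `ES × F → ES × F` of normed spaces is `C^n` for the product models. [cite: FritzscheGrauert2002, Ch. I §7] -/
theorem contMDiffOn_prod_of_contDiffOn {n : WithTop ℕ∞} {f : ES × F → ES × F} {s : Set (ES × F)} (hf : ContDiffOn ℂ n f s) :
    ContMDiffOn (𝓘(ℂ, ES).prod 𝓘(ℂ, F)) (𝓘(ℂ, ES).prod 𝓘(ℂ, F)) n f s := by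
  have h := contMDiffOn_iff_contDiffOn.2 hf
  rw [modelWithCornersSelf_prod, ← chartedSpaceSelf_prod] at h
  exact h

omit [FiniteDimensional ℂ EA] [FiniteDimensional ℂ ES] [FiniteDimensional ℂ F] in
/-- A map into `ES × F` which is `C^n` for the self model is `C^n` for the product model. [cite: FritzscheGrauert2002, Ch. I §7] -/
theorem contMDiffOn_toProd {n : WithTop ℕ∞} {f : MA → ES × F} {s : Set MA} (hf : ContMDiffOn 𝓘(ℂ, EA) 𝓘(ℂ, ES × F) n f s) :
    ContMDiffOn 𝓘(ℂ, EA) (𝓘(ℂ, ES).prod 𝓘(ℂ, F)) n f s := by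
  rw [modelWithCornersSelf_prod, ← chartedSpaceSelf_prod] at hf
  exact hf

omit [FiniteDimensional ℂ EA] [FiniteDimensional ℂ ES] [FiniteDimensional ℂ F] in
/-- A map out of `ES × F` which is `C^n` for the self model is `C^n` for the product model. [cite: FritzscheGrauert2002, Ch. I §7] -/
theorem contMDiffOn_fromProd {n : WithTop ℕ∞} {f : ES × F → MA} {s : Set (ES × F)} (hf : ContMDiffOn 𝓘(ℂ, ES × F) 𝓘(ℂ, EA) n f s) :
    ContMDiffOn (𝓘(ℂ, ES).prod 𝓘(ℂ, F)) 𝓘(ℂ, EA) n f s := by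
  rw [modelWithCornersSelf_prod, ← chartedSpaceSelf_prod] at hf
  exact hf

omit [FiniteDimensional ℂ ES] [FiniteDimensional ℂ F] in
/-- `(chartAt m)⁻¹ × id : ES × F ⇀ MS × F` is `C^n` on `(chartAt m).target × F`, for the self model on the source. [cite: FritzscheGrauert2002, Ch. I §7] -/
theorem contMDiffOn_chartSymm_prod {n : WithTop ℕ∞} [IsManifold 𝓘(ℂ, ES) n MS] (m : MS) :
    ContMDiffOn 𝓘(ℂ, ES × F) (𝓘(ℂ, ES).prod 𝓘(ℂ, F)) n (Prod.map (chartAt ES m).symm (@id F)) ((chartAt ES m).target ×ˢ (univ : Set F)) := by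
  have h : ContMDiffOn (𝓘(ℂ, ES).prod 𝓘(ℂ, F)) (𝓘(ℂ, ES).prod 𝓘(ℂ, F)) n (Prod.map (chartAt ES m).symm (@id F))
      ((chartAt ES m).target ×ˢ (univ : Set F)) :=
    contMDiffOn_chart_symm.prodMap contMDiffOn_id
  rw [modelWithCornersSelf_prod, ← chartedSpaceSelf_prod]
  exact h

omit [FiniteDimensional ℂ ES] [FiniteDimensional ℂ F] in
/-- `(chartAt m) × id : MS × F ⇀ ES × F` is `C^n` on `(chartAt m).source × F`, for the self model on the target. [cite: FritzscheGrauert2002, Ch. I §7] -/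
theorem contMDiffOn_chart_prod {n : WithTop ℕ∞} [IsManifold 𝓘(ℂ, ES) n MS] (m : MS) :
    ContMDiffOn (𝓘(ℂ, ES).prod 𝓘(ℂ, F)) 𝓘(ℂ, ES × F) n (Prod.map (chartAt ES m) (@id F)) ((chartAt ES m).source ×ˢ (univ : Set F)) := by
  have h : ContMDiffOn (𝓘(ℂ, ES).prod 𝓘(ℂ, F)) (𝓘(ℂ, ES).prod 𝓘(ℂ, F)) n (Prod.map (chartAt ES m) (@id F))
      ((chartAt ES m).source ×ˢ (univ : Set F)) :=
    contMDiffOn_chart.prodMap contMDiffOn_id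
  rw [modelWithCornersSelf_prod, ← chartedSpaceSelf_prod]
  exact h

/-! ## §2 The vertical multiplier is `c`, chart-independently -/

omit [FiniteDimensional ℂ EA] [FiniteDimensional ℂ ES] in
/-- **The fibre derivative of the conjugated self-map along the section is the dilation `c • id`.**  Let `Θ₀ : MA ⇀ ES × F` be bi-`C^ω` (self
models), `two : MA → MA` differentiable, and `π : F → MA` differentiable with `two (π z) = π (c • z)`, injective differential at `0`, `π 0 ∈ Θ₀.source`,
`Θ₀ (π 0) = (b, 0)`, and `(Θ₀ (π z)).1 = b` whenever `π z ∈ Θ₀.source`.  Then `w ↦ (Θ₀ (two (Θ₀⁻¹ (b, w)))).2` has derivative `c • id` at `0`.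
(With `τ := pr₂ ∘ Θ₀ ∘ π`: `G (b, τ z) = τ (c • z)` near `0` and `dτ(0)` is invertible.) [cite: Milnor2006, §8 Thm. 8.2 (proof)] [cite: Sternberg1957, Thm. 1] -/
theorem fderiv_vertical_eq_smul [IsManifold 𝓘(ℂ, EA) ω MA] (Θ₀ : OpenPartialHomeomorph MA (ES × F))
    (hΘ : ContMDiffOn 𝓘(ℂ, EA) 𝓘(ℂ, ES × F) ω Θ₀ Θ₀.source)
    (hΘs : ContMDiffOn 𝓘(ℂ, ES × F) 𝓘(ℂ, EA) ω Θ₀.symm Θ₀.target)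
    {two : MA → MA} (htwo : MDifferentiable 𝓘(ℂ, EA) 𝓘(ℂ, EA) two)
    {π : F → MA} (hπd : MDifferentiable 𝓘(ℂ, F) 𝓘(ℂ, EA) π) {c : ℂ} (hconj : ∀ z : F, two (π z) = π (c • z))
    (hinj : Injective (mfderiv 𝓘(ℂ, F) 𝓘(ℂ, EA) π 0))
    {b : ES} (h0 : π 0 ∈ Θ₀.source) (hΘπ0 : Θ₀ (π 0) = (b, 0))
    (hfst : ∀ z : F, π z ∈ Θ₀.source → (Θ₀ (π z)).1 = b) :
    fderiv ℂ (fun w : F ↦ (Θ₀ (two (Θ₀.symm (b, w)))).2) 0 = c • ContinuousLinearMap.id ℂ F := by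
  have hΘmd : Θ₀.MDifferentiable 𝓘(ℂ, EA) 𝓘(ℂ, ES × F) :=
    ⟨hΘ.mdifferentiableOn (by simp), hΘs.mdifferentiableOn (by simp)⟩
  /- `σ := Θ₀ ∘ π` and its injective derivative at `0` -/
  set σ : F → ES × F := fun z ↦ Θ₀ (π z) with hσ
  set A : EA →L[ℂ] ES × F := mfderiv 𝓘(ℂ, EA) 𝓘(ℂ, ES × F) Θ₀ (π 0) with hA
  set D : F →L[ℂ] EA := mfderiv 𝓘(ℂ, F) 𝓘(ℂ, EA) π 0 with hD
  have hΘat : MDifferentiableAt 𝓘(ℂ, EA) 𝓘(ℂ, ES × F) Θ₀ (π 0) :=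
    (hΘmd.1 _ h0).mdifferentiableAt (Θ₀.open_source.mem_nhds h0)
  have hσder : HasFDerivAt σ (A.comp D) 0 :=
    hasMFDerivAt_iff_hasFDerivAt.1 (hΘat.hasMFDerivAt.comp 0 (hπd 0).hasMFDerivAt)
  have hAinj : Injective A := (hΘmd.mfderiv_bijective h0).1
  have hσinj : Injective (A.comp D) := hAinj.comp hinj
  /- the first coordinate of `σ` is constant near `0`, so `dτ(0) = pr₂ ∘ dσ(0)` is injective, hence invertible -/
  have hev : ∀ᶠ z in 𝓝 (0 : F), π z ∈ Θ₀.source := (hπd 0).continuousAt.preimage_mem_nhds (Θ₀.open_source.mem_nhds h0)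
  have hfst0 : (ContinuousLinearMap.fst ℂ ES F).comp (A.comp D) = 0 := by
    have h1 : HasFDerivAt (fun z ↦ (σ z).1) ((ContinuousLinearMap.fst ℂ ES F).comp (A.comp D)) 0 :=
      (ContinuousLinearMap.fst ℂ ES F).hasFDerivAt.comp 0 hσder
    have h2 : (fun z ↦ (σ z).1) =ᶠ[𝓝 0] fun _ ↦ b := by
      filter_upwards [hev] with z hz
      exact hfst z hz
    exact h1.unique ((hasFDerivAt_const b (0 : F)).congr_of_eventuallyEq h2)
  set T : F →L[ℂ] F := (ContinuousLinearMap.snd ℂ ES F).comp (A.comp D) with hT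
  have hτder : HasFDerivAt (fun z ↦ (σ z).2) T 0 := (ContinuousLinearMap.snd ℂ ES F).hasFDerivAt.comp 0 hσder
  have hTinj : Injective T := by
    intro v v' h
    apply hσinj
    refine Prod.ext ?_ h
    have h1 : (A (D v)).1 = 0 := by simpa using ContinuousLinearMap.ext_iff.1 hfst0 v
    have h2 : (A (D v')).1 = 0 := by simpa using ContinuousLinearMap.ext_iff.1 hfst0 v'
    show (A (D v)).1 = (A (D v')).1
    rw [h1, h2]
  have hTbij : Bijective T := ⟨hTinj, (LinearMap.injective_iff_surjective (f := (T : F →ₗ[ℂ] F))).1 hTinj⟩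
  let Te : F ≃L[ℂ] F := LinearEquiv.toContinuousLinearEquiv (LinearEquiv.ofBijective (T : F →ₗ[ℂ] F) hTbij)
  have hTe : ∀ v, Te v = T v := fun v ↦ rfl
  /- the conjugation identity `G (b, τ z) = τ (c • z)` near `0` -/
  set Gb : F → F := fun w ↦ (Θ₀ (two (Θ₀.symm (b, w)))).2 with hGb
  have hτ0 : (σ 0).2 = 0 := by simp only [hσ, hΘπ0]
  have hident : (Gb ∘ fun z ↦ (σ z).2) =ᶠ[𝓝 0] fun z ↦ (σ (c • z)).2 := by
    filter_upwards [hev] with z hz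
    have hbz : ((b, (Θ₀ (π z)).2) : ES × F) = Θ₀ (π z) := Prod.ext (hfst z hz).symm rfl
    show (Θ₀ (two (Θ₀.symm (b, (Θ₀ (π z)).2)))).2 = (Θ₀ (π (c • z))).2
    rw [hbz, Θ₀.left_inv hz, hconj z]
  /- `Gb` is differentiable at `0` (a composite of differentiable maps read in the self models) -/
  have hb0tgt : ((b, (0 : F)) : ES × F) ∈ Θ₀.target := by rw [← hΘπ0]; exact Θ₀.map_source h0
  have hsymmb : Θ₀.symm (b, 0) = π 0 := by rw [← hΘπ0, Θ₀.left_inv h0]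
  have hGbd : DifferentiableAt ℂ Gb 0 := by
    have h1 : MDifferentiableAt 𝓘(ℂ, F) 𝓘(ℂ, ES × F) (fun w : F ↦ ((b, w) : ES × F)) 0 :=
      mdifferentiableAt_iff_differentiableAt.2 ((differentiableAt_const _).prodMk differentiableAt_id)
    have h2 : MDifferentiableAt 𝓘(ℂ, ES × F) 𝓘(ℂ, EA) Θ₀.symm ((b, (0 : F)) : ES × F) :=
      (hΘmd.2 _ hb0tgt).mdifferentiableAt (Θ₀.open_target.mem_nhds hb0tgt)
    have h3 : MDifferentiableAt 𝓘(ℂ, EA) 𝓘(ℂ, EA) two (Θ₀.symm (b, 0)) := htwo _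
    have h4 : MDifferentiableAt 𝓘(ℂ, EA) 𝓘(ℂ, ES × F) Θ₀ (two (Θ₀.symm (b, 0))) := by
      rw [hsymmb, hconj, smul_zero]; exact hΘat
    have h5 : MDifferentiableAt 𝓘(ℂ, ES × F) 𝓘(ℂ, F) (fun q : ES × F ↦ q.2) (Θ₀ (two (Θ₀.symm (b, 0)))) :=
      mdifferentiableAt_iff_differentiableAt.2 differentiableAt_snd
    have s1 := h2.comp (0 : F) h1
    have s2 := h3.comp (0 : F) s1
    have s3 := h4.comp (0 : F) s2
    have s4 := h5.comp (0 : F) s3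
    exact mdifferentiableAt_iff_differentiableAt.1 s4
  set DG : F →L[ℂ] F := fderiv ℂ Gb 0 with hDG
  have hGbder : HasFDerivAt Gb DG ((σ 0).2) := by rw [hτ0]; exact hGbd.hasFDerivAt
  /- differentiate the identity -/
  have hL : HasFDerivAt (Gb ∘ fun z ↦ (σ z).2) (DG.comp T) 0 := hGbder.comp 0 hτder
  have hR : HasFDerivAt (fun z : F ↦ (σ (c • z)).2) (T.comp (c • ContinuousLinearMap.id ℂ F)) 0 := by
    have hτ' : HasFDerivAt (fun z ↦ (σ z).2) T (c • (0 : F)) := by rw [smul_zero]; exact hτder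
    exact hτ'.comp 0 ((hasFDerivAt_id (0 : F)).const_smul c)
  have hDT : DG.comp T = T.comp (c • ContinuousLinearMap.id ℂ F) := hL.unique (hR.congr_of_eventuallyEq hident)
  ext w
  obtain ⟨v, rfl⟩ := hTbij.2 w
  have h := ContinuousLinearMap.ext_iff.1 hDT v
  simp only [ContinuousLinearMap.coe_comp, comp_apply, smul_apply, ContinuousLinearMap.id_apply, map_smul] at h ⊢
  exact h

/-! ## §3 The linearising chart -/

/-- **THE LINEARISING CHART** (road B organ B2 «LINCHART» with an arbitrary `C^ω` base map `p`).  Let `p : MA → MS` and `zero : MS → MA` be `C^ω`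
with `p ∘ zero = id`, `two : MA → MA` a `C^ω` self-map over `p` fixing the section (`two ∘ zero = zero`), `dim EA = dim ES + dim F`, and suppose
that through every `zero u` there is a holomorphic DILATION-EQUIVARIANT map `π : F → MA` over `u` (`two (π z) = π (c • z)`, `1 < ‖c‖`) with
injective differential at `0`.  Then at every `m` there is a chart `Θ : MA ⇀ MS × F` with `zero m ∈ Θ.source`, `C^ω` with `C^ω` inverse, first
coordinate `p`, `Θ (zero u) = (u, 0)`, LINEARISING `two`: `Θ (two a) = ((Θ a).1, c • (Θ a).2)` whenever `a, two a ∈ Θ.source`.  (The `p`-adapted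
tubular chart ★ `SectionTubularChart.exists_sectionTubularChart`, in which `two = (b, G (b, w))` with `G (b, 0) = 0`, `∂_w G (b, 0) = c • id` by §2;
then Kœnigs with parameters ★ `KoenigsLinearization.exists_linearizing_openPartialHomeomorph`, and back to `MS × F` by `(chartAt m)⁻¹ × id`.)
[cite: Koenigs1884] [cite: Sternberg1957, Thm. 1] [cite: Milnor2006, Thm. 8.2, Cor. 8.4] [cite: FritzscheGrauert2002, Ch. I §7 Thm. 7.6] -/
theorem exists_linearising_chart [IsManifold 𝓘(ℂ, EA) ω MA] [IsManifold 𝓘(ℂ, ES) ω MS]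
    (p : MA → MS) (two : MA → MA) (zero : MS → MA) (m : MS) {c : ℂ} (hc : 1 < ‖c‖)
    (hdim : Module.finrank ℂ EA = Module.finrank ℂ ES + Module.finrank ℂ F)
    (hp : ContMDiff 𝓘(ℂ, EA) 𝓘(ℂ, ES) ω p)
    (htwo : ContMDiff 𝓘(ℂ, EA) 𝓘(ℂ, EA) ω two)
    (hzero : ContMDiff 𝓘(ℂ, ES) 𝓘(ℂ, EA) ω zero)
    (hp_two : ∀ a : MA, p (two a) = p a)
    (hp_zero : ∀ u : MS, p (zero u) = u)
    (htwo_zero : ∀ u : MS, two (zero u) = zero u)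
    (hπ : ∀ u : MS, ∃ π : F → MA,
      MDifferentiable 𝓘(ℂ, F) 𝓘(ℂ, EA) π ∧ π 0 = zero u ∧ (∀ z : F, p (π z) = u) ∧ (∀ z : F, two (π z) = π (c • z)) ∧
      Injective (mfderiv 𝓘(ℂ, F) 𝓘(ℂ, EA) π 0)) :
    ∃ Θ : OpenPartialHomeomorph MA (MS × F),
      zero m ∈ Θ.source ∧
      ContMDiffOn 𝓘(ℂ, EA) (𝓘(ℂ, ES).prod 𝓘(ℂ, F)) ω Θ Θ.source ∧
      ContMDiffOn (𝓘(ℂ, ES).prod 𝓘(ℂ, F)) 𝓘(ℂ, EA) ω Θ.symm Θ.target ∧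
      (∀ a ∈ Θ.source, (Θ a).1 = p a) ∧
      (∀ u : MS, zero u ∈ Θ.source → Θ (zero u) = (u, 0)) ∧
      (∀ a ∈ Θ.source, two a ∈ Θ.source → Θ (two a) = ((Θ a).1, c • (Θ a).2)) := by
  haveI : CompleteSpace F := FiniteDimensional.complete ℂ F
  set χ := extChartAt 𝓘(ℂ, ES) m with hχ
  have hχcoe : ∀ y : MS, χ y = chartAt ES m y := fun _ ↦ rfl
  have hχsymm : ∀ y : ES, χ.symm y = (chartAt ES m).symm y := fun _ ↦ rfl
  /- the tubular chart at `zero m` -/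
  obtain ⟨πm, hπmd, hπm0, hpπm, -, hπminj⟩ := hπ m
  obtain ⟨Θ₀, h0src, hΘ, hΘs, hpsrc, hsat, hfst, hzeroΘ, hsymm0⟩ :=
    SectionTubularChart.exists_sectionTubularChart p zero m hdim hp hzero hp_zero (hπmd 0) hπm0 hpπm hπminj
  have hΘmd : Θ₀.MDifferentiable 𝓘(ℂ, EA) 𝓘(ℂ, ES × F) :=
    ⟨hΘ.mdifferentiableOn (by simp), hΘs.mdifferentiableOn (by simp)⟩
  have htwod : MDifferentiable 𝓘(ℂ, EA) 𝓘(ℂ, EA) two := htwo.mdifferentiable (by simp)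
  /- `two` read in the chart: `G` on the open set `N` -/
  set N : Set (ES × F) := Θ₀.target ∩ Θ₀.symm ⁻¹' (two ⁻¹' Θ₀.source) with hN
  have hNopen : IsOpen N := Θ₀.isOpen_inter_preimage_symm (Θ₀.open_source.preimage htwo.continuous)
  set G : ES × F → F := fun q ↦ (Θ₀ (two (Θ₀.symm q))).2 with hG
  set b₀ : ES := χ m with hb₀
  have hΘzero_m : Θ₀ (zero m) = (b₀, 0) := hzeroΘ m h0src
  have hb₀N : ((b₀, (0 : F)) : ES × F) ∈ N := by
    refine ⟨by rw [← hΘzero_m]; exact Θ₀.map_source h0src, ?_⟩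
    show two (Θ₀.symm (b₀, 0)) ∈ Θ₀.source
    rw [← hΘzero_m, Θ₀.left_inv h0src, htwo_zero]
    exact h0src
  have hGdiff : DifferentiableOn ℂ G N := by
    have h1 : MDifferentiableOn 𝓘(ℂ, ES × F) 𝓘(ℂ, EA) (two ∘ Θ₀.symm) N :=
      htwod.comp_mdifferentiableOn (hΘmd.2.mono inter_subset_left)
    have h2 : MDifferentiableOn 𝓘(ℂ, ES × F) 𝓘(ℂ, ES × F) (Θ₀ ∘ two ∘ Θ₀.symm) N :=
      hΘmd.1.comp h1 fun q hq ↦ hq.2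
    have h3 : MDifferentiableOn 𝓘(ℂ, ES × F) 𝓘(ℂ, F) (fun q : ES × F ↦ q.2) univ :=
      (mdifferentiableOn_iff_differentiableOn.2 differentiableOn_snd)
    exact mdifferentiableOn_iff_differentiableOn.1 (h3.comp h2 fun _ _ ↦ mem_univ _)
  /- points of `N` on the section: `(b, 0) ∈ N` determines `u' := (chartAt m).symm b` with `Θ₀.symm (b, 0) = zero u'`, `χ u' = b` -/
  have hsec : ∀ b : ES, ((b, (0 : F)) : ES × F) ∈ N →
      Θ₀.symm (b, 0) = zero (χ.symm b) ∧ zero (χ.symm b) ∈ Θ₀.source ∧ χ (χ.symm b) = b := by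
    intro b hb
    have h1 : Θ₀.symm (b, 0) = zero (χ.symm b) := hsymm0 (b, 0) hb.1 rfl
    have h2 : zero (χ.symm b) ∈ Θ₀.source := by rw [← h1]; exact Θ₀.map_target hb.1
    refine ⟨h1, h2, ?_⟩
    have h3 := hfst _ h2
    rw [hp_zero, ← h1, Θ₀.right_inv hb.1] at h3
    exact h3.symm
  have hG0 : ∀ b : ES, ((b, (0 : F)) : ES × F) ∈ N → G (b, 0) = 0 := by
    intro b hb
    obtain ⟨h1, h2, h3⟩ := hsec b hb
    show (Θ₀ (two (Θ₀.symm (b, 0)))).2 = 0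
    rw [h1, htwo_zero, hzeroΘ _ h2]
  have hGd : ∀ b : ES, ((b, (0 : F)) : ES × F) ∈ N → fderiv ℂ (fun w : F ↦ G (b, w)) 0 = c • ContinuousLinearMap.id ℂ F := by
    intro b hb
    obtain ⟨h1, h2, h3⟩ := hsec b hb
    obtain ⟨π, hπd', hπ0, hpπ', hconj, hinj⟩ := hπ (χ.symm b)
    have h0 : π 0 ∈ Θ₀.source := by rw [hπ0]; exact h2
    have hΘπ0 : Θ₀ (π 0) = (b, 0) := by rw [hπ0, hzeroΘ _ h2, h3]
    have hfstπ : ∀ z : F, π z ∈ Θ₀.source → (Θ₀ (π z)).1 = b := fun z hz ↦ by rw [hfst _ hz, hpπ', h3]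
    exact fderiv_vertical_eq_smul Θ₀ hΘ hΘs htwod hπd' hconj hinj h0 hΘπ0 hfstπ
  /- Kœnigs with parameters -/
  obtain ⟨ρ, hρ, s, hs, 𝒦, h𝒦tgt, h𝒦N, -, h𝒦b0, h𝒦fst, -, h𝒦zero, h𝒦an, h𝒦san, -, -, h𝒦conj⟩ :=
    Literature.Analysis.Complex.KoenigsLinearization.exists_linearizing_openPartialHomeomorph hNopen hb₀N hGdiff hG0 hGd hc
  /- back to `MS × F` -/
  let Ξ : OpenPartialHomeomorph (ES × F) (MS × F) := (chartAt ES m).symm.prod (OpenPartialHomeomorph.refl F)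
  have hΞsrc : Ξ.source = (chartAt ES m).target ×ˢ (univ : Set F) := rfl
  have hΞapply : ∀ q : ES × F, Ξ q = ((chartAt ES m).symm q.1, q.2) := fun _ ↦ rfl
  let Θ : OpenPartialHomeomorph MA (MS × F) := (Θ₀.trans 𝒦).trans Ξ
  have hΘapply : ∀ a : MA, Θ a = Ξ (𝒦 (Θ₀ a)) := fun _ ↦ rfl
  have hΘsrc : ∀ a : MA, a ∈ Θ.source ↔ a ∈ Θ₀.source ∧ Θ₀ a ∈ 𝒦.source ∧ 𝒦 (Θ₀ a) ∈ Ξ.source := by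
    intro a
    simp only [Θ, OpenPartialHomeomorph.trans_source, mem_inter_iff, mem_preimage, OpenPartialHomeomorph.coe_trans, comp_apply,
      and_assoc]
  /- the first coordinate of `𝒦 (Θ₀ a)` is `χ (p a)`, which lies in the ball `ball b₀ ρ` and in `(chartAt m).target` -/
  have hfst𝒦 : ∀ a : MA, a ∈ Θ₀.source → Θ₀ a ∈ 𝒦.source → (𝒦 (Θ₀ a)).1 = χ (p a) := fun a ha ha' ↦ by
    rw [h𝒦fst _ ha', hfst _ ha]
  have hball : ∀ q ∈ 𝒦.source, q.1 ∈ ball b₀ ρ := fun q hq ↦ by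
    have h := 𝒦.map_source hq
    rw [h𝒦tgt] at h
    rw [← h𝒦fst q hq]
    exact h.1
  refine ⟨Θ, ?_, ?_, ?_, ?_, ?_, ?_⟩
  · -- `zero m ∈ Θ.source`
    rw [hΘsrc]
    have h1 : Θ₀ (zero m) ∈ 𝒦.source := by rw [hΘzero_m]; exact h𝒦b0 b₀ (mem_ball_self hρ)
    refine ⟨h0src, h1, ?_⟩
    rw [hΘzero_m, h𝒦zero b₀ (mem_ball_self hρ), hΞsrc]
    exact ⟨by rw [hb₀, hχcoe]; exact mem_chart_target ES m, mem_univ _⟩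
  · -- `Θ` is `C^ω`
    have h𝒦ω : ContMDiffOn 𝓘(ℂ, ES × F) 𝓘(ℂ, ES × F) ω 𝒦 𝒦.source :=
      contMDiffOn_iff_contDiffOn.2 h𝒦an.contDiffOn_of_completeSpace
    have hΞω : ContMDiffOn 𝓘(ℂ, ES × F) (𝓘(ℂ, ES).prod 𝓘(ℂ, F)) ω Ξ Ξ.source := contMDiffOn_chartSymm_prod m
    have h1 : ContMDiffOn 𝓘(ℂ, EA) 𝓘(ℂ, ES × F) ω (𝒦 ∘ Θ₀) (Θ₀.trans 𝒦).source :=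
      h𝒦ω.comp (hΘ.mono fun a ha ↦ ha.1) fun a ha ↦ ha.2
    have h2 : ContMDiffOn 𝓘(ℂ, EA) (𝓘(ℂ, ES).prod 𝓘(ℂ, F)) ω (Ξ ∘ 𝒦 ∘ Θ₀) Θ.source :=
      hΞω.comp (h1.mono fun a ha ↦ ha.1) fun a ha ↦ ha.2
    exact h2
  · -- `Θ.symm` is `C^ω`
    have h𝒦sω : ContMDiffOn 𝓘(ℂ, ES × F) 𝓘(ℂ, ES × F) ω 𝒦.symm 𝒦.target :=
      contMDiffOn_iff_contDiffOn.2 h𝒦san.contDiffOn_of_completeSpace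
    have hΞsω : ContMDiffOn (𝓘(ℂ, ES).prod 𝓘(ℂ, F)) 𝓘(ℂ, ES × F) ω Ξ.symm Ξ.target := contMDiffOn_chart_prod m
    have h1 : ContMDiffOn 𝓘(ℂ, ES × F) 𝓘(ℂ, EA) ω (Θ₀.symm ∘ 𝒦.symm) (Θ₀.trans 𝒦).target :=
      hΘs.comp (h𝒦sω.mono fun q hq ↦ hq.1) fun q hq ↦ hq.2
    have h2 : ContMDiffOn (𝓘(ℂ, ES).prod 𝓘(ℂ, F)) 𝓘(ℂ, EA) ω ((Θ₀.symm ∘ 𝒦.symm) ∘ Ξ.symm) Θ.target :=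
      h1.comp (hΞsω.mono fun q hq ↦ hq.1) fun q hq ↦ hq.2
    exact h2
  · -- first coordinate `p`
    intro a ha
    obtain ⟨ha0, ha𝒦, -⟩ := (hΘsrc a).1 ha
    rw [hΘapply, hΞapply, hfst𝒦 a ha0 ha𝒦, hχcoe]
    exact (chartAt ES m).left_inv (hpsrc a ha0)
  · -- the section is `{w = 0}`
    intro u hu
    obtain ⟨hu0, hu𝒦, -⟩ := (hΘsrc _).1 hu
    have hΘu : Θ₀ (zero u) = (χ u, 0) := hzeroΘ u hu0
    have hball' : χ u ∈ ball b₀ ρ := by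
      have h := hball _ hu𝒦
      rwa [hΘu] at h
    rw [hΘapply, hΘu, h𝒦zero _ hball', hΞapply, hχcoe]
    have hu' : u ∈ (chartAt ES m).source := by
      have h := hpsrc _ hu0
      rwa [hp_zero] at h
    exact Prod.ext ((chartAt ES m).left_inv hu') rfl
  · -- conjugacy
    intro a ha hta
    obtain ⟨ha0, ha𝒦, -⟩ := (hΘsrc a).1 ha
    obtain ⟨hta0, hta𝒦, -⟩ := (hΘsrc _).1 hta
    have hq : Θ₀ (two a) = ((Θ₀ a).1, G (Θ₀ a)) := by
      refine Prod.ext ?_ ?_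
      · rw [hfst _ hta0, hfst _ ha0, hp_two]
      · show (Θ₀ (two a)).2 = (Θ₀ (two (Θ₀.symm (Θ₀ a)))).2
        rw [Θ₀.left_inv ha0]
    have hconj𝒦 : 𝒦 (Θ₀ (two a)) = ((Θ₀ a).1, c • (𝒦 (Θ₀ a)).2) := by
      rw [hq]
      exact h𝒦conj _ ha𝒦 (by rw [← hq]; exact hta𝒦)
    rw [hΘapply, hΘapply, hconj𝒦, hΞapply, hΞapply, h𝒦fst _ ha𝒦]

end Literature.Geometry.ComplexAnalytic.DoublingLinearisingChart

end
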